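import Summits.KontsevichZagierPeriods.KontsevichZagierPeriods.Theses.FermatIsogeny
import Literature.Analysis.SpecialFunctions.GammaMultiplication
import Literature.Analysis.SpecialFunctions.SelbergIntegralBasic
import Literature.NumberTheory.Transcendental.KZCalculus
import Literature.NumberTheory.Transcendental.KZCalculusProofs
import Summits.KontsevichZagierPeriods.KontsevichZagierPeriods.Theorems.FermatIsogenyBetaLinearSectorSplit
import Summits.KontsevichZagierPeriods.KontsevichZagierPeriods.Theorems.FermatIsogenyDirichletNinth
import Summits.KontsevichZagierPeriods.KontsevichZagierPeriods.Theorems.FermatIsogenyReflectionNinth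
import Summits.KontsevichZagierPeriods.KontsevichZagierPeriods.Theorems.FermatIsogenyTriplicationGlue

/-!
# `IsogenyLinearNinth` is an instance of `BetaLinearSector` (route FermatIsogeny: crux 2 ⟸ crux 3)

The route's rank-2 kill switch `IsogenyLinearNinth` (stmt-KontsevichZagierPeriods-3896: the 1-dimensional representations
`[∫₀¹ x^{-4/9}(1-x)^{-2/9} dx] = [B(5/9,7/9)]` and `[(8/3)·3^{1/6}·sin(π/9)·x^{-1/9}(1-x)^{-4/9}] = [c·B(8/9,5/9)]` are
KZ-equivalent) is LITERALLY the instance `a = 5/9, b = 7/9, a' = 8/9, b' = 5/9, c = (8/3)·3^{1/6}·sin(π/9)` of the rank-3 crux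
`BetaLinearSector` (stmt-3897), because the VALUE IDENTITY `B(5/9,7/9) = c·B(8/9,5/9)` holds: it is Gauss's triplication
`Γ(1/9)Γ(4/9)Γ(7/9) = 2π·3^{1/6}·Γ(1/3)` (the case `n = 3`, `x = 1/9` of Gauss's multiplication formula, PROVED in the tree:
`GaussMultiplication.real_formula`) combined with Euler's reflection `Γ(1/9)Γ(8/9) = π/sin(π/9)` and `Γ(x+1) = xΓ(x)`.
This file proves the value identity (`beta_five_seven_ninth_eq`), the algebraicity of `c` (`sin(π/9)` is a root of
`16X⁶ − 24X⁴ + 9X² − 3/4`, from `sin 3θ = 3 sin θ − 4 sin³θ` and `sin²(π/3) = 3/4`), and the implication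
`isogenyLinearNinth_of_betaLinearSector : BetaLinearSector → IsogenyLinearNinth`; with the landed
`BetaLinearSector_of_subs` (Theorems/FermatIsogenyBetaLinearSectorSplit.lean) the kill switch is thus reduced to the named fact
`HuberWustholzCurvePeriods` and the Green lemma, and through the proved `TriplicationGlue` so is `TriplicationAccessible` (0312).

References: G. E. Andrews, R. Askey, R. Roy, *Special Functions* (1999), Thm 1.5.2 (Gauss) and Thm 1.1.4 (Beta integral);
N. Koblitz, D. Rohrlich, *Simple factors in the Jacobian of a Fermat curve*, Canad. J. Math. 30 (1978), Thm 3 (`N = 9`).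
-/

noncomputable section

namespace Summit.KontsevichZagierPeriods.FermatIsogeny.BetaLinearSector

open Real MeasureTheory Set
open Literature.NumberTheory.Transcendental
open Literature.Analysis.SpecialFunctions
open Summit.KontsevichZagierPeriods.KontsevichZagierPeriods.Theses.FermatIsogeny (BetaLinearSector IsogenyLinearNinth
  TriplicationAccessible)

/-! ## Gauss's triplication at `1/9` and the value identity -/

/-- **Gauss's triplication at `1/9`**: `Γ(1/9)·Γ(4/9)·Γ(7/9) = 2π·3^{1/6}·Γ(1/3)` — the case `n = 3`, `x = 1/9` of the
multiplication formula `(∏_{k<3} Γ(x + k/3))·3^{3x} = Γ(3x)·√3·2π` (`GaussMultiplication.real_formula`, proved in the tree).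
[cite: AndrewsAskeyRoy1999, Thm 1.5.2] -/
theorem Gamma_ninth_triplication :
    Gamma (1 / 9) * Gamma (4 / 9) * Gamma (7 / 9) = 2 * π * (3 : ℝ) ^ ((1 : ℝ) / 6) * Gamma (1 / 3) := by
  have h := GaussMultiplication.real_formula (n := 3) (by norm_num) (x := 1 / 9) (by norm_num)
  have hprod : GaussMultiplication.prodGamma 3 (1 / 9) = Gamma (1 / 9) * Gamma (4 / 9) * Gamma (7 / 9) := by
    simp only [GaussMultiplication.prodGamma, Finset.prod_range_succ, Finset.prod_range_zero, one_mul]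
    norm_num
  rw [hprod] at h
  have h3 : ((3 : ℕ) : ℝ) = 3 := by norm_num
  rw [h3] at h
  have hpow : (3 : ℝ) ^ ((3 : ℝ) * (1 / 9)) = (3 : ℝ) ^ ((1 : ℝ) / 3) := by norm_num
  have hsqrt : Real.sqrt 3 = (3 : ℝ) ^ ((1 : ℝ) / 2) := by rw [Real.sqrt_eq_rpow]
  have htwo : (2 * π) ^ (((3 : ℝ) - 1) / 2) = 2 * π := by norm_num
  rw [hpow, hsqrt, htwo, show (3 : ℝ) * (1 / 9) = 1 / 3 by norm_num] at h
  -- divide by `3^{1/3}`: `3^{1/2} / 3^{1/3} = 3^{1/6}`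
  have h13 : (0 : ℝ) < (3 : ℝ) ^ ((1 : ℝ) / 3) := Real.rpow_pos_of_pos (by norm_num) _
  have hsplit : (3 : ℝ) ^ ((1 : ℝ) / 2) = (3 : ℝ) ^ ((1 : ℝ) / 6) * (3 : ℝ) ^ ((1 : ℝ) / 3) := by
    rw [← Real.rpow_add (by norm_num : (0 : ℝ) < 3)]
    norm_num
  rw [hsplit] at h
  have h' : (Gamma (1 / 9) * Gamma (4 / 9) * Gamma (7 / 9) - 2 * π * (3 : ℝ) ^ ((1 : ℝ) / 6) * Gamma (1 / 3)) *
      (3 : ℝ) ^ ((1 : ℝ) / 3) = 0 := by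
    linear_combination h
  rcases mul_eq_zero.1 h' with h0 | h0
  · linarith
  · exact absurd h0 h13.ne'

/-- **The value identity of the kill switch**: `B(5/9,7/9) = (8/3)·3^{1/6}·sin(π/9)·B(8/9,5/9)`, written with
`B(a,b) = Γ(a)Γ(b)/Γ(a+b)`; from the triplication at `1/9`, the reflection `Γ(1/9)Γ(8/9) = π/sin(π/9)` and `Γ(x+1) = xΓ(x)`
(`Γ(12/9) = Γ(1/3)/3`, `Γ(13/9) = (4/9)Γ(4/9)`). [cite: KoblitzRohrlich1978, Thm 3] [cite: AndrewsAskeyRoy1999, Thm 1.5.2] -/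
theorem beta_five_seven_ninth_eq :
    Gamma (5 / 9) * Gamma (7 / 9) / Gamma (5 / 9 + 7 / 9) =
      8 / 3 * (3 : ℝ) ^ ((1 : ℝ) / 6) * sin (π / 9) * (Gamma (8 / 9) * Gamma (5 / 9) / Gamma (8 / 9 + 5 / 9)) := by
  have hT := Gamma_ninth_triplication
  have hR : Gamma (1 / 9) * Gamma (8 / 9) = π / sin (π / 9) := by
    have h := Real.Gamma_mul_Gamma_one_sub (1 / 9 : ℝ)
    rw [show (1 : ℝ) - 1 / 9 = 8 / 9 by norm_num, show π * (1 / 9 : ℝ) = π / 9 by ring] at h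
    exact h
  have h12 : Gamma (5 / 9 + 7 / 9) = (1 / 3 : ℝ) * Gamma (1 / 3) := by
    rw [show (5 / 9 + 7 / 9 : ℝ) = 1 / 3 + 1 by norm_num, Real.Gamma_add_one (by norm_num)]
  have h13 : Gamma (8 / 9 + 5 / 9) = (4 / 9 : ℝ) * Gamma (4 / 9) := by
    rw [show (8 / 9 + 5 / 9 : ℝ) = 4 / 9 + 1 by norm_num, Real.Gamma_add_one (by norm_num)]
  have hsin : 0 < sin (π / 9) := Real.sin_pos_of_pos_of_lt_pi (by positivity) (by linarith [Real.pi_pos])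
  have hG19 : 0 < Gamma (1 / 9) := Real.Gamma_pos_of_pos (by norm_num)
  have hG13 : 0 < Gamma (1 / 3) := Real.Gamma_pos_of_pos (by norm_num)
  have hG49 : 0 < Gamma (4 / 9) := Real.Gamma_pos_of_pos (by norm_num)
  have hG59 : 0 < Gamma (5 / 9) := Real.Gamma_pos_of_pos (by norm_num)
  have hG89 : Gamma (8 / 9) = π / sin (π / 9) / Gamma (1 / 9) := by
    rw [← hR]; field_simp
  rw [h12, h13, hG89]
  -- clear denominators and reduce to the triplication identity
  have hπ : 0 < π := Real.pi_pos
  field_simp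
  -- goal is polynomial in the Gamma values, `π`, `sin`, `3^{1/6}`; substitute the triplication
  nlinarith [hT, hG19, hG13, hG49, hG59, hsin, hπ, mul_pos hG59 hG49, mul_pos (mul_pos hG59 hG49) hsin,
    Real.rpow_pos_of_pos (by norm_num : (0:ℝ) < 3) ((1:ℝ)/6)]

/-! ## Algebraicity of the constant -/

/-- `sin(π/9)` is algebraic: with `s = sin(π/9)`, `sin(π/3) = 3s − 4s³` and `sin²(π/3) = 3/4`, so `s` is a root of
`16X⁶ − 24X⁴ + 9X² − 3/4 ∈ ℚ[X]`. [folklore] -/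
theorem isAlgebraic_sin_pi_div_nine : IsAlgebraic ℚ (sin (π / 9)) := by
  set s : ℝ := sin (π / 9) with hs
  have h3 : sin (π / 3) = 3 * s - 4 * s ^ 3 := by
    rw [show π / 3 = 3 * (π / 9) by ring, Real.sin_three_mul]
  have hsq : (3 * s - 4 * s ^ 3) ^ 2 = 3 / 4 := by rw [← h3, Real.sq_sin_pi_div_three]
  refine ⟨16 * Polynomial.X ^ 6 - 24 * Polynomial.X ^ 4 + 9 * Polynomial.X ^ 2 - Polynomial.C (3 / 4), ?_, ?_⟩
  · intro h
    have h0 := congrArg (fun p : Polynomial ℚ => p.coeff 0) h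
    simp at h0
  · simp only [map_sub, map_add, map_mul, map_pow, Polynomial.aeval_X, Polynomial.aeval_C, map_ofNat]
    have : (algebraMap ℚ ℝ) (3 / 4) = 3 / 4 := by simp
    rw [this]
    nlinarith [hsq]

/-- The constant `c = (8/3)·3^{1/6}·sin(π/9)` of the kill switch is real algebraic. [folklore] -/
theorem isAlgebraic_tripConst : IsAlgebraic ℚ ((8 / 3 : ℝ) * (3 : ℝ) ^ ((1 : ℝ) / 6) * sin (π / 9)) := by
  have h3 : IsAlgebraic ℚ ((3 : ℝ) ^ ((1 : ℝ) / 6)) := by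
    refine IsAlgebraic.of_pow (by norm_num : 0 < 6) ?_
    rw [← Real.rpow_natCast, ← Real.rpow_mul (by norm_num : (0:ℝ) ≤ 3)]
    norm_num
    exact isAlgebraic_nat 3
  have h83 : IsAlgebraic ℚ ((8 / 3 : ℝ)) := by
    have h : IsAlgebraic ℚ (((8 / 3 : ℚ)) : ℝ) := isAlgebraic_rat ℚ _
    norm_num at h
    exact h
  exact (h83.mul h3).mul isAlgebraic_sin_pi_div_nine

/-! ## The kill switch is an instance of the beta-linear sector -/

/-- The value of a representation pinned on `(0,1)` as `[k · t^{a-1}(1-t)^{b-1}]` (`a, b > 0`) is `k·Γ(a)Γ(b)/Γ(a+b)`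
(the Beta integral, `Selberg.integrableOn_Ioo_rpow_mul_one_sub_rpow_and_integral_eq`). [cite: AndrewsAskeyRoy1999, Thm 1.1.4] -/
theorem value_eq_of_pinned (k a b : ℝ) (ha : 0 < a) (hb : 0 < b) (r : KZ.IntegralRep 1)
    (hd : r.domain = {x | x 0 ∈ Set.Ioo (0:ℝ) 1})
    (hi : Set.EqOn r.integrand (fun x => k * (x 0) ^ (a - 1) * (1 - x 0) ^ (b - 1)) r.domain) :
    r.value = k * (Gamma a * Gamma b / Gamma (a + b)) := by
  rw [KZ.IntegralRep.value, setIntegral_congr_fun (KZ.IntegralRep.measurableSet_domain_holds r) hi, hd]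
  have h1 := (volume_preserving_funUnique (Fin 1) ℝ).setIntegral_preimage_emb
    (MeasurableEquiv.funUnique (Fin 1) ℝ).measurableEmbedding
    (fun t : ℝ => k * t ^ (a - 1) * (1 - t) ^ (b - 1)) (Ioo (0:ℝ) 1)
  have h2 : ∫ t in Ioo (0:ℝ) 1, k * t ^ (a - 1) * (1 - t) ^ (b - 1) = k * (Gamma a * Gamma b / Gamma (a + b)) := by
    rw [← (Selberg.integrableOn_Ioo_rpow_mul_one_sub_rpow_and_integral_eq ha hb).2, ← integral_const_mul]
    congr 1
    funext t
    ring
  rw [← h2, ← h1]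
  rfl

/-- **`BetaLinearSector → IsogenyLinearNinth`** (crux 2 of route FermatIsogeny is the instance `a = 5/9, b = 7/9, a' = 8/9,
b' = 5/9, c = (8/3)·3^{1/6}·sin(π/9)` of crux 3): the exponents match after `push_cast`, `c` is algebraic
(`isAlgebraic_tripConst`), and the two values agree by the Beta integral and `beta_five_seven_ninth_eq` (Gauss triplication +
reflection). [cite: KoblitzRohrlich1978, Thm 3] [cite: AndrewsAskeyRoy1999, Thm 1.5.2] -/
theorem isogenyLinearNinth_of_betaLinearSector :
    Summit.KontsevichZagierPeriods.KontsevichZagierPeriods.Theses.FermatIsogeny.BetaLinearSector →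
    Summit.KontsevichZagierPeriods.KontsevichZagierPeriods.Theses.FermatIsogeny.IsogenyLinearNinth := by
  intro hB r r' hd hi hd' hi'
  have hi₁ : Set.EqOn r.integrand (fun x => (x 0) ^ (((5 / 9 : ℚ) : ℝ) - 1) * (1 - x 0) ^ (((7 / 9 : ℚ) : ℝ) - 1))
      r.domain := by
    intro x hx
    rw [hi hx]
    norm_num
  have hi₁' : Set.EqOn r'.integrand (fun x => (8 / 3 * (3 : ℝ) ^ ((1 : ℝ) / 6) * sin (π / 9)) *
      (x 0) ^ (((8 / 9 : ℚ) : ℝ) - 1) * (1 - x 0) ^ (((5 / 9 : ℚ) : ℝ) - 1)) r'.domain := by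
    intro x hx
    rw [hi' hx]
    norm_num
  have hv : r.value = (1 : ℝ) * (Gamma (5 / 9) * Gamma (7 / 9) / Gamma (5 / 9 + 7 / 9)) := by
    refine value_eq_of_pinned 1 (5 / 9) (7 / 9) (by norm_num) (by norm_num) r hd fun x hx => ?_
    rw [hi hx]
    norm_num
  have hv' : r'.value = (8 / 3 * (3 : ℝ) ^ ((1 : ℝ) / 6) * sin (π / 9)) *
      (Gamma (8 / 9) * Gamma (5 / 9) / Gamma (8 / 9 + 5 / 9)) := by
    refine value_eq_of_pinned _ (8 / 9) (5 / 9) (by norm_num) (by norm_num) r' hd' fun x hx => ?_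
    rw [hi' hx]
    norm_num
  have hval : r.value = r'.value := by
    rw [hv, hv', one_mul, beta_five_seven_ninth_eq]
  exact hB (5 / 9) (7 / 9) (8 / 9) (5 / 9) _ (by norm_num) (by norm_num) (by norm_num) (by norm_num)
    isAlgebraic_tripConst r r' hd hi₁ hd' hi₁' hval

/-! ## Consequences: the kill switch and the triplication pair from Huber–Wüstholz and Green -/

/-- **The kill switch from the named fact and Green**: `HuberWustholzCurvePeriods → (greenSet ⊆ relations) → IsogenyLinearNinth`
(through `BetaLinearSector_of_subs`, Theorems/FermatIsogenyBetaLinearSectorSplit.lean). CONDITIONAL on both hypotheses.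
[cite: HuberWustholz2022, Thm 13.3 (2)] -/
theorem isogenyLinearNinth_of_huberWustholz_of_green (hHW : Literature.NumberTheory.Transcendental.HuberWustholzCurvePeriods)
    (hG : ∀ g ∈ Summit.KontsevichZagierPeriods.SymplecticScissors.RealOnePeriodRelationsNegative.greenSet,
      g ∈ Literature.NumberTheory.Transcendental.KZ.relations) :
    IsogenyLinearNinth :=
  isogenyLinearNinth_of_betaLinearSector (BetaLinearSector_of_subs hHW hG)

/-- **Gauss's triplication pair 0312 (`TriplicationAccessible`) from the named fact and Green**, through the proved supports of
the route: `triplicationGlue_proof` (IsogenyLinearNinth → DirichletNinth → ReflectionNinth → TriplicationAccessible),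
`dirichletNinth_proof`, `reflectionNinth_proof`. CONDITIONAL on both hypotheses. [cite: HuberWustholz2022, Thm 13.3 (2)] -/
theorem triplicationAccessible_of_huberWustholz_of_green
    (hHW : Literature.NumberTheory.Transcendental.HuberWustholzCurvePeriods)
    (hG : ∀ g ∈ Summit.KontsevichZagierPeriods.SymplecticScissors.RealOnePeriodRelationsNegative.greenSet,
      g ∈ Literature.NumberTheory.Transcendental.KZ.relations) :
    TriplicationAccessible :=
  Summit.KontsevichZagierPeriods.KontsevichZagierPeriods.Theorems.triplicationGlue_proof
    (isogenyLinearNinth_of_huberWustholz_of_green hHW hG)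
    Summit.KontsevichZagierPeriods.KontsevichZagierPeriods.Theorems.dirichletNinth_proof
    Summit.KontsevichZagierPeriods.KontsevichZagierPeriods.Theorems.reflectionNinth_proof

end Summit.KontsevichZagierPeriods.FermatIsogeny.BetaLinearSector

end
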